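import Literature.MathematicalPhysics.QuantumFieldTheory.Balaban1983to89.B15Ineq191Lattice
import Literature.MathematicalPhysics.QuantumFieldTheory.Balaban1983to89.B15HDecayLeaves

/-!
# `Balaban1983to89.B15Ineq180Lattice` — [Balaban1989LargeFieldI] p. 195 **(1.80)**: *«it follows also quite generally
# from the definition (1.79) and the bound (1.78)»* KERNEL-CHECKED as a mechanism on the `ℤ^d` lattice carriers — (1.80)
# from the standard representation of `U₀ = U_{k,Z}(V_Λ)` against `U_{k,Z}` of the fixed extension, the `ℍ`-bounds of
# the printed shape, and (1.75); and the `ℍ`-bounds themselves from (190) of [15] for a field localised on `Λ`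

statement-level skeleton of published theorems with citation tags; proofs where landed; nothing here is a claim about
the Yang–Mills mass gap.

Cell pub-ymgap, HUMAN RULING D-0062 (Track A full width), seat `pub-ymgap-dag-n12-b` (-b FIRST-MISSING-ESTIMATE of DAG
node N12 = [B15]; leaf `DagBinding.B15Leaf`, conjunct `i180 : ∀ p, B15.Ineq180 (W.dev180 p) …`).  T. Bałaban, *Large
field renormalization. I. The basic step of the 𝐑 operation*, Commun. Math. Phys. **122**, 175–202 (1989)
[Balaban1989LargeFieldI] (cell paper B15 = «[IV]»; PDF held `paper:balaban1989-cmp122-large-field-i`, journal page =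
PDF page + 174; pp. 183–184, 193, 195 = PDF 9–10, 19, 21, text layer re-read by this seat 2026-08-25); «[15]» = T.
Bałaban, CMP **102** (1985) 277–309 [Balaban1985Variational], Prop. 9 ∕ (190) p. 308.  SKELETON row `B15.Eq1.80`
(owner r12): *«typed-existing · proof deferred in print»* — the leaf `B15.Ineq180` (unit r2) had NO derivation; every
located use of (1.80) consumes the leaf (`B15Ineq191Lattice.ineq198_lattice`, `B15Membership195`).

THE PRINT (verbatim).  p. 195 [PDF 21]: *«Extend the function V_Λ on the whole domain Z putting V_Λ = V_k on Z∩Λᶜ, and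
define U₀ = U_{k,Z}(V_Λ). (1.79) … To simplify the description we take into account the characteristic function χ_{k,Λ}.
The restrictions introduced by this function, and the method of construction of the function V_Λ, imply the estimate
|U₀(∂p) − 1| < 2ε_kη² + O(1)B₃B₅M⁵exp(−δ dist(p, Λ))ε_kη² (1.80) for p ∈ Ω_k. We will discuss it together with the
proof of Proposition 1, because then it will be immediate, but it follows also quite generally from the definition
(1.79) and the bound (1.78). … We do not show the above statement now, because we will need a stronger statement in the
future.»*  p. 193 [PDF 19]: (1.75) *«χ_{k,Λ} = χ({inf_{V_k↾_Λ} sup_{p∈Ω_kᶜ} |U_{k,Z}(∂p) − 1| < 2ε_kη²})»*, *«It means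
that this field has an extension on the whole domain Z, such that the extended field satisfies the regularity condition
in (1.75)»*; p. 194 (1.78) *«|V_Λ(∂p′) − 1| < B₅M⁵ε for p′ ∈ Λ»*.  The representation: p. 184 [PDF 10] *«Now we
represent the configuration U(…) in the standard way, as in (1.30)»* (1.34)–(1.36), p. 186 (1.44)–(1.46) *«Using the
representation (1.44), and the above estimate, we obtain (1.46)»*, p. 198 (1.90)–(1.91) *«Estimating as in (1.46) we
get (1.91)»* — at scale `k` the exponent scale is `L^{k−k}η = η`.  [15] (190) p. 308: *«|(δ/δB_ν(y′))𝓗_μ(B,x)|,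
|∇_x(δ/δB_ν(y′))𝓗_μ(B,x)|, … ≤ O(1)[(L^jη)^{−1}, (L^jη)^{−2}, …]·(L^{j′}η)^{−d} exp(−⅛δ₀d(y,y′))»*.

THE MECHANISM TYPED HERE (the cell's reading of *«quite generally from the definition (1.79) and the bound (1.78)»*;
READING DECLARED, referee columns F6/F7).  Write `W` for the fixed extension of `V_k↾_{Z∩Λᶜ}` of p. 193 and `U₁ =
U_{k,Z}(W)`; `V_Λ = V′W` with `V′ = exp iB′` supported on `Λ` and small by (1.78) (in a gauge on `Λ`); the standard
representation gives `U₀ = U_{k,Z}(V′W) = (exp(iηℍ)·U₁)^{g}` with `ℍ = ℍ_{k,Z}(B′)` hermitian and a gauge transformation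
`g`; the lattice mechanism of (1.46) (p29's `B15Ineq146Proof.mechanism_iEta`, r12's `B15Ineq191Lattice.dev_le_oneSup`)
gives `|U₀(∂p) − 1| ≤ |U₁(∂p) − 1| + (X + 8X²)η²` from `|ℍ(b)| ≤ X` on `∂p` and `|(D^ηℍ)(p)| ≤ X`; (1.75) for `W` gives
`|U₁(∂p) − 1| < 2ε_kη²`; and the decay (190) of `δℍ` for the argument `B′` LOCALISED ON `Λ` with B-size `≤ m ≤
K·B₅M⁵ε_k` gives `X ≤ B₃·K·B₅M⁵ε_k·e^{−δ·dist(p,Λ)}` (r12's `B15HDecayLeaves.loc_le_of_meanValue`, one piece); the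
quadratic term is absorbed under the smallness `8K·B₃B₅M⁵ε_k ≤ 1`: (1.80) with `O(1) = 2K`.

WHAT IS PROVED (0 `sorry`, no `def`, no new `Prop`; Mathlib + the two imports; BY NAME, nothing restated:
`B15Ineq191Lattice.dev_le_oneSup`/`dev_le_twoSup`, `B15HDecayLeaves.loc_le_of_meanValue`, the leaf `B15.Ineq180`).
§1 `ineq180_arith` — the absorption arithmetic: `dev ≤ dev₁ + (cX + 8X²)η²`, `dev₁ < 2ε_kη²`, `0 ≤ X ≤ K·Q`,
   `Q = B₃B₅M⁵e^{−δ·dist}ε_k ≤ B₃B₅M⁵ε_k`, `8K·B₃B₅M⁵ε_k ≤ 1` ⇒ `B15.Ineq180 dev ε_k η B₃ B₅ M δ dist ((c+1)K)`.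
§2 **`ineq180_lattice`** — **(1.80) ON THE LATTICE**: on the `ℤ^d` carriers of `B15Ineq146Proof` (`𝔸` a C⋆-algebra,
   `U₁`, `g` valued in `{|u| ≤ 1, |u⁻¹| ≤ 1}`, `ℍ` hermitian, `η > 0`), from the representation `U₀ = (e^{iηℍ}U₁)^{g}`, the
   one-sup `ℍ`-bounds `≤ X ≤ K·B₃B₅M⁵e^{−δ·dist}ε_k` at `p`, (1.75) at `p` for `U₁`, `0 ≤ δ·dist` and the smallness ⇒
   `B15.Ineq180 |U₀(∂p) − 1| ε_k η B₃ B₅ M δ dist (2K)`; `ineq180_lattice_twoSup` — the componentwise two-derivative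
   reading ((3.4) of [13]) with `O(1) = 3K`.
§3 **`ineq180_of_ineq190`** — **(1.80) FROM (1.78) + (190)**: the `ℍ`-bound of §2 DERIVED in the block-majorant
   vocabulary of [15] §G (`B11SectG.BlockNorm`/`Ineq190`/`RowSum` over `g : B6.Geometry`): (190) for every base-point
   derivative `dH t` with constants `C, δ₀`, the row sum (2.61) of [3] at rate `σ` with constant `c`, a rate `τ` with
   `σ + τ ≤ ⅛δ₀`, the argument `B′` with B-size `≤ m` on every block and vanishing on the blocks `y′` with `d(y,y′) < D`
   (`D = d(y, Λ)`: *«exp(−δ dist(p, Λ))»*), the mean-value domination of `ℍ(B′)` by its base-point derivatives (r12's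
   `hmv`), `Cκ_Bc ≤ B₃` (print's factor `B₃`), `m ≤ K·B₅M⁵ε_k` ((1.78) in bond form, `K` = the gauge bookkeeping
   constant), the DICTIONARY identifying the local size `bout.loc y (ℍB′)` with an upper bound of the five lattice
   quantities at `p ⊂ Δ(y)`, (1.75) at `p`, smallness ⇒ `B15.Ineq180 |U₀(∂p) − 1| ε_k η B₃ B₅ M τ D (2K)`.

HONEST SCOPE (located, nothing repaired).  (i) The representation `U₀ = (e^{iηℍ}U₁)^{g}` (existence of `ℍ_{k,Z}`, `g`:
[15] Sect. G ∕ (1.30)), (190) itself, (2.61), the mean-value reading `hmv`, the B-size∕localisation of `B′` and the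
dictionary between block sizes and lattice sups are DATA ∕ HYPOTHESES of the printed shapes, exactly as in r12's
`B15HDecayLeaves` ∕ `B15Ineq191Lattice`.  (ii) *«(1.78) in bond form»*: (1.78) bounds PLAQUETTE variables (`B₅M⁵ε`); a
bond field `B′` with `V_Λ = e^{iB′}W` small needs a gauge on `Λ` — print's own bond form is (1.83) p. 197, *«|V_Λ(b) − 1| <
O(1)B₅M⁶ε_k»* in the axial gauge (tree: `B15Ineq183AxialGauge`), one power of `M` more; the hypothesis `m ≤ K·B₅M⁵ε_k`
keeps print's exponent and puts that power (or the choice of a better gauge) into `K` — cell reading notes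
G-B15-p26-04 ∕ G-B16-02 territory, recorded here, not resolved.  (iii) The DOMAIN of (1.80) (*«for p ∈ Ω_k»* vs the
(1.75) domain `Ω_kᶜ`, GAPS G-adv7-25, `B15Membership195` (r1′)) is not touched: the theorem is per plaquette and takes
the (1.75)-type input `|U₁(∂p) − 1| < 2ε_kη²` AT THAT PLAQUETTE.  (iv) `ε` of Proposition 1 is `ε_k`-proportional in
print's use ((1.75): `2ε_k`; p. 193: `ε < L₀^{2N₀}ε_k`); the hypothesis `m ≤ K·B₅M⁵ε_k` absorbs that factor too.
Value = the deferred (1.80) reduced to ONE typed published inequality ((190)) plus the located data of its own sentence,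
kernel-checked, with print's constants; count-neutral; NOT summit progress.
-/

open scoped BigOperators
open NormedSpace Finset Complex

namespace Literature.MathematicalPhysics.QuantumFieldTheory.Balaban1983to89.B15Ineq180Lattice

open B7Prop1Explicit
open B8Lemma1NonAbelian (mulCfg)
open B8Ineq132 (plaqF covDerivFwd)
open B8Eq146AExpansion (plaqCovDeriv expCfg iEta)
open B15Ineq191Lattice (dev_le_oneSup dev_le_twoSup)
open B11SectG (BlockNorm Ineq190 RowSum)

-- `Site` alone could resolve to the torus sites of `Setup.lean` through a parent namespace; re-export the `ℤ^d`
-- sites of `B7Prop1Explicit` (as in `B15Ineq146Proof`, `B15Ineq191Lattice`).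
export B7Prop1Explicit (Site)

/-! ## §1. The absorption arithmetic of (1.80) -/

/-- **The arithmetic of (1.80).**  From the mechanism output `dev ≤ dev₁ + (cX + 8X²)η²` (`c ≥ 0`: `c = 1` one-sup,
`c = 2` two-sup reading), the (1.75)-input `dev₁ < 2ε_kη²`, the `ℍ`-bound `0 ≤ X ≤ K·B₃B₅M⁵e^{−δ·dist}ε_k` (`K ≥ 0`,
`B₃B₅M⁵ε_k ≥ 0`, `δ·dist ≥ 0`) and the smallness `8K·B₃B₅M⁵ε_k ≤ 1` absorbing the quadratic term:
`B15.Ineq180 dev ε_k η B₃ B₅ M δ dist ((c + 1)K)`, i.e. *«|U₀(∂p) − 1| < 2ε_kη² + O(1)B₃B₅M⁵exp(−δ dist(p, Λ))ε_kη²»* with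
`O(1) = (c + 1)K`. [cite: Balaban1989LargeFieldI, (1.80) p.195] -/
theorem ineq180_arith {dev dev₁ X c K εk η B₃ B₅ M δ dist : ℝ}
    (hle : dev ≤ dev₁ + (c * X + 8 * X ^ 2) * η ^ 2) (h175 : dev₁ < 2 * εk * η ^ 2) (hc : 0 ≤ c) (hX0 : 0 ≤ X)
    (hX : X ≤ K * (B₃ * B₅ * M ^ 5 * Real.exp (-δ * dist) * εk)) (hK : 0 ≤ K) (hP : 0 ≤ B₃ * B₅ * M ^ 5 * εk)
    (hδd : 0 ≤ δ * dist) (hsmall : 8 * K * (B₃ * B₅ * M ^ 5 * εk) ≤ 1) :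
    B15.Ineq180 dev εk η B₃ B₅ M δ dist ((c + 1) * K) := by
  unfold B15.Ineq180
  -- the decaying quantity `Q = B₃B₅M⁵e^{−δ·dist}ε_k` against the plain one `P = B₃B₅M⁵ε_k`
  set Q : ℝ := B₃ * B₅ * M ^ 5 * Real.exp (-δ * dist) * εk with hQdef
  set P : ℝ := B₃ * B₅ * M ^ 5 * εk with hPdef
  have hE1 : Real.exp (-δ * dist) ≤ 1 := Real.exp_le_one_iff.mpr (by linarith)
  have hQP : Q = P * Real.exp (-δ * dist) := by rw [hQdef, hPdef]; ring
  have hQ0 : 0 ≤ Q := by rw [hQP]; exact mul_nonneg hP (Real.exp_pos _).le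
  have hQle : Q ≤ P := by
    rw [hQP]; exact (mul_le_mul_of_nonneg_left hE1 hP).trans (mul_one P).le
  have hKQ0 : 0 ≤ K * Q := mul_nonneg hK hQ0
  have hKQP : K * Q ≤ K * P := mul_le_mul_of_nonneg_left hQle hK
  have h8 : 8 * (K * Q) ≤ 1 := by
    calc 8 * (K * Q) ≤ 8 * (K * P) := by linarith
      _ = 8 * K * P := by ring
      _ ≤ 1 := hsmall
  -- `cX + 8X² ≤ KQ(c + 8KQ) ≤ (c + 1)KQ`
  have hX2 : X ^ 2 ≤ (K * Q) ^ 2 := pow_le_pow_left₀ hX0 hX 2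
  have h1 : c * X ≤ c * (K * Q) := mul_le_mul_of_nonneg_left hX hc
  have h2 : 8 * (K * Q) ^ 2 ≤ K * Q := by nlinarith
  have hsum : c * X + 8 * X ^ 2 ≤ (c + 1) * (K * Q) := by nlinarith
  have hη2 : 0 ≤ η ^ 2 := sq_nonneg η
  have hterm : (c * X + 8 * X ^ 2) * η ^ 2 ≤ (c + 1) * (K * Q) * η ^ 2 := mul_le_mul_of_nonneg_right hsum hη2
  have hring : (c + 1) * (K * Q) * η ^ 2 = (c + 1) * K * B₃ * B₅ * M ^ 5 * Real.exp (-δ * dist) * εk * η ^ 2 := by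
    rw [hQdef]; ring
  linarith

/-! ## §2. (1.80) on the `ℤ^d` lattice carriers -/

variable {d : ℕ} {𝔸 : Type*} [CStarAlgebra 𝔸] [Nontrivial 𝔸]

/-- **(1.80) p. 195 ON THE LATTICE** (one-sup reading).  Data: `U₁ = U_{k,Z}(W)` for the fixed extension `W` of
`V_k↾_{Z∩Λᶜ}` (p. 193) and a gauge transformation `g`, both valued in `{|u| ≤ 1, |u⁻¹| ≤ 1}`; `ℍ = ℍ_{k,Z}(B′)` hermitian,
`η > 0`; the standard representation `U₀ = U_{k,Z}(V_Λ) = (e^{iηℍ}U₁)^{g}` ((1.79) with (1.30)∕(1.34)∕(1.44), scale `k`);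
the `ℍ`-bounds at `p`: `|ℍ(b)| ≤ X` on the four bonds of `∂p` and `|(D^η_{U₁}ℍ)(p)| ≤ X` with `X ≤ K·B₃B₅M⁵e^{−δ·dist}ε_k`
((190)-decay for `B′` localised on `Λ` and small by (1.78): §3); (1.75) at `p` for the extension: `|U₁(∂p) − 1| <
2ε_kη²`; `0 ≤ δ·dist`, `K ≥ 0`, `B₃B₅M⁵ε_k ≥ 0` and the smallness `8K·B₃B₅M⁵ε_k ≤ 1`.  Conclusion: the leaf
`B15.Ineq180 |U₀(∂p) − 1| ε_k η B₃ B₅ M δ dist (2K)` — *«|U₀(∂p) − 1| < 2ε_kη² + O(1)B₃B₅M⁵exp(−δ dist(p, Λ))ε_kη²»*,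
`O(1) = 2K`. [cite: Balaban1989LargeFieldI, (1.79)–(1.80) p.195, (1.75) p.193, (1.46) p.186] -/
theorem ineq180_lattice {η : ℝ} (hη : 0 < η) {U₁ : Site d → Fin d → 𝔸ˣ} (h₁ : ∀ y κ, U₁ y κ ∈ U1 𝔸)
    {H : Site d → Fin d → 𝔸} (hH : ∀ y κ, IsSelfAdjoint (H y κ)) {g : Site d → 𝔸ˣ} (hg : ∀ y, g y ∈ U1 𝔸)
    (μ ν : Fin d) (x : Site d) {X K εk B₃ B₅ M δ dist : ℝ}
    (hH₁ : ‖H x μ‖ ≤ X) (hH₂ : ‖H (x + e μ) ν‖ ≤ X) (hH₃ : ‖H (x + e ν) μ‖ ≤ X) (hH₄ : ‖H x ν‖ ≤ X)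
    (hDH : ‖plaqCovDeriv η U₁ H μ ν x‖ ≤ X)
    (hX : X ≤ K * (B₃ * B₅ * M ^ 5 * Real.exp (-δ * dist) * εk)) (hK : 0 ≤ K)
    (hP : 0 ≤ B₃ * B₅ * M ^ 5 * εk) (hδd : 0 ≤ δ * dist) (hsmall : 8 * K * (B₃ * B₅ * M ^ 5 * εk) ≤ 1)
    (h175 : ‖plaqF U₁ μ ν x - 1‖ < 2 * εk * η ^ 2) :
    B15.Ineq180 ‖plaqF (gaugeAct g (mulCfg (expCfg (iEta η H)) U₁)) μ ν x - 1‖ εk η B₃ B₅ M δ dist (2 * K) := by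
  have hle := dev_le_oneSup hη h₁ hH hg μ ν x hH₁ hH₂ hH₃ hH₄ hDH
  have hX0 : 0 ≤ X := (norm_nonneg _).trans hH₁
  have hle' : ‖plaqF (gaugeAct g (mulCfg (expCfg (iEta η H)) U₁)) μ ν x - 1‖
      ≤ ‖plaqF U₁ μ ν x - 1‖ + (1 * X + 8 * X ^ 2) * η ^ 2 := by simpa only [one_mul] using hle
  have h := ineq180_arith hle' h175 zero_le_one hX0 hX hK hP hδd hsmall
  have h2 : ((1 : ℝ) + 1) * K = 2 * K := by norm_num
  rw [h2] at h
  exact h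

/-- **(1.80) on the lattice under the two-sup reading**: the two covariant derivatives `|(∇^η_{U₁,μ}ℍ_ν)(x)|,
|(∇^η_{U₁,ν}ℍ_μ)(x)| ≤ X` instead of the plaquette derivative ((3.4) of [Balaban1985BackgroundPropagators], r12's
`dev_le_twoSup`); the leaf holds with `O(1) = 3K`. [cite: Balaban1989LargeFieldI, (1.80) p.195, (1.46) p.186] -/
theorem ineq180_lattice_twoSup {η : ℝ} (hη : 0 < η) {U₁ : Site d → Fin d → 𝔸ˣ} (h₁ : ∀ y κ, U₁ y κ ∈ U1 𝔸)
    {H : Site d → Fin d → 𝔸} (hH : ∀ y κ, IsSelfAdjoint (H y κ)) {g : Site d → 𝔸ˣ} (hg : ∀ y, g y ∈ U1 𝔸)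
    (μ ν : Fin d) (x : Site d) {X K εk B₃ B₅ M δ dist : ℝ}
    (hH₁ : ‖H x μ‖ ≤ X) (hH₂ : ‖H (x + e μ) ν‖ ≤ X) (hH₃ : ‖H (x + e ν) μ‖ ≤ X) (hH₄ : ‖H x ν‖ ≤ X)
    (hDH₁ : ‖covDerivFwd η U₁ μ (fun y => H y ν) x‖ ≤ X) (hDH₂ : ‖covDerivFwd η U₁ ν (fun y => H y μ) x‖ ≤ X)
    (hX : X ≤ K * (B₃ * B₅ * M ^ 5 * Real.exp (-δ * dist) * εk)) (hK : 0 ≤ K)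
    (hP : 0 ≤ B₃ * B₅ * M ^ 5 * εk) (hδd : 0 ≤ δ * dist) (hsmall : 8 * K * (B₃ * B₅ * M ^ 5 * εk) ≤ 1)
    (h175 : ‖plaqF U₁ μ ν x - 1‖ < 2 * εk * η ^ 2) :
    B15.Ineq180 ‖plaqF (gaugeAct g (mulCfg (expCfg (iEta η H)) U₁)) μ ν x - 1‖ εk η B₃ B₅ M δ dist (3 * K) := by
  have hle := dev_le_twoSup hη h₁ hH hg μ ν x hH₁ hH₂ hH₃ hH₄ hDH₁ hDH₂
  have hX0 : 0 ≤ X := (norm_nonneg _).trans hH₁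
  have h := ineq180_arith hle h175 (by norm_num) hX0 hX hK hP hδd hsmall
  have h3 : ((2 : ℝ) + 1) * K = 3 * K := by norm_num
  rw [h3] at h
  exact h

/-! ## §3. The `ℍ`-bound from (190) for a field localised on `Λ`, and (1.80) from (1.78) + (190) -/

/-- **(1.80) FROM (1.78) + (190).**  Block-majorant data over `gB : B6.Geometry` (r12's `B15HDecayLeaves` vocabulary):
`bB` the B-size of argument fields, `bout` a local size of `ℍ`-values, every base-point derivative `dH t` of `ℍ = ℍ_{k,Z}`
with (190) (constants `C ≥ 0`, `δ₀`), the row sum (2.61) at rate `σ` with constant `c ≥ 0`, a rate `τ ≥ 0` with `σ + τ ≤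
⅛δ₀`; the argument `B′` (`V_Λ = e^{iB′}W` on `Λ`) with `bB.loc y′ B′ ≤ m` everywhere and `= 0` unless `D ≤ d(y, y′)`
(`B′` localised on `Λ`, `D = d(y, Λ) ≥ 0`); the mean-value domination `hmv` of `ℍB′ = ℍ(B′)`; print's letters `Cκ_Bc ≤ B₃`
and `m ≤ K·B₅M⁵ε_k` (*«the bound (1.78)»* in bond form, `K ≥ 0`); the DICTIONARY: the local size `bout.loc y ℍB′` bounds
`|ℍ(b)|` on the four bonds of `∂p` and `|(D^η_{U₁}ℍ)(p)|` for the plaquette `p = p_{μν}(x) ⊂ Δ(y)` of the lattice datum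
`ℍ`; the representation `U₀ = (e^{iηℍ}U₁)^{g}` and (1.75) at `p` as in §2; smallness `8K·B₃B₅M⁵ε_k ≤ 1`.  Conclusion:
`B15.Ineq180 |U₀(∂p) − 1| ε_k η B₃ B₅ M τ D (2K)` — (1.80) with `δ = τ`, `dist(p, Λ) = D`, `O(1) = 2K`.  BY NAME:
`B15HDecayLeaves.loc_le_of_meanValue` (the one localised piece) and `ineq180_lattice`.
[cite: Balaban1989LargeFieldI, (1.78) p.194, (1.79)–(1.80) p.195; Balaban1985Variational, (190) p.308;
Balaban1984PropagatorsII, (2.61) p.234] -/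
theorem ineq180_of_ineq190 {gB : B6.Geometry} {FB FA : Type} [AddCommGroup FB] [Module ℝ FB] [AddCommGroup FA]
    [Module ℝ FA] {T : Type*} {bB : BlockNorm gB FB} {bout : BlockNorm gB FA} {dH : T → FB →ₗ[ℝ] FA}
    {C δ₀ σ τ c m D : ℝ} (h190 : ∀ t, Ineq190 bB bout (dH t) C δ₀) (hC : 0 ≤ C)
    (hd : ∀ a b : gB.Site, 0 ≤ gB.dist a b) (hrow : RowSum gB σ c) (hc : 0 ≤ c) (hτ : 0 ≤ τ)
    (hστ : σ + τ ≤ δ₀ / 8) (B' : FB) (hm : ∀ y', bB.loc y' B' ≤ m) (y : gB.Site)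
    (hD : ∀ y', bB.loc y' B' ≠ 0 → D ≤ gB.dist y y') (hD0 : 0 ≤ D)
    {HB : FA} (hmv : ∀ s : ℝ, (∀ t, bout.loc y (dH t B') ≤ s) → bout.loc y HB ≤ s)
    {B₃ B₅ M εk K : ℝ} (hB₃ : C * bB.κ * c ≤ B₃) (hK : 0 ≤ K) (hmK : m ≤ K * (B₅ * M ^ 5 * εk))
    (hP : 0 ≤ B₅ * M ^ 5 * εk) (hsmall : 8 * K * (B₃ * B₅ * M ^ 5 * εk) ≤ 1)
    {η : ℝ} (hη : 0 < η) {U₁ : Site d → Fin d → 𝔸ˣ} (h₁ : ∀ z κ, U₁ z κ ∈ U1 𝔸)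
    {H : Site d → Fin d → 𝔸} (hH : ∀ z κ, IsSelfAdjoint (H z κ)) {g : Site d → 𝔸ˣ} (hg : ∀ z, g z ∈ U1 𝔸)
    (μ ν : Fin d) (x : Site d)
    (hH₁ : ‖H x μ‖ ≤ bout.loc y HB) (hH₂ : ‖H (x + e μ) ν‖ ≤ bout.loc y HB)
    (hH₃ : ‖H (x + e ν) μ‖ ≤ bout.loc y HB) (hH₄ : ‖H x ν‖ ≤ bout.loc y HB)
    (hDH : ‖plaqCovDeriv η U₁ H μ ν x‖ ≤ bout.loc y HB)
    (h175 : ‖plaqF U₁ μ ν x - 1‖ < 2 * εk * η ^ 2) :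
    B15.Ineq180 ‖plaqF (gaugeAct g (mulCfg (expCfg (iEta η H)) U₁)) μ ν x - 1‖ εk η B₃ B₅ M τ D (2 * K) := by
  -- the one localised piece: `bout.loc y ℍB′ ≤ Cκ_Bc·m·e^{−τD}`
  have hX := B15HDecayLeaves.loc_le_of_meanValue h190 hC hd hrow hτ hστ B' hm y hD hmv
  -- letters: `Cκ_Bc ≤ B₃`, `m ≤ K·B₅M⁵ε_k`
  have hm0 : 0 ≤ m := (bB.loc_nonneg y B').trans (hm y)
  have hCκc : 0 ≤ C * bB.κ * c := mul_nonneg (mul_nonneg hC bB.κ_nonneg) hc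
  have hB₃0 : 0 ≤ B₃ := hCκc.trans hB₃
  have hE0 : 0 ≤ Real.exp (-(τ * D)) := (Real.exp_pos _).le
  have hmE : 0 ≤ m * Real.exp (-(τ * D)) := mul_nonneg hm0 hE0
  have hX' : bout.loc y HB ≤ K * (B₃ * B₅ * M ^ 5 * Real.exp (-τ * D) * εk) := by
    calc bout.loc y HB ≤ C * bB.κ * c * m * Real.exp (-(τ * D)) := hX
      _ = (C * bB.κ * c) * (m * Real.exp (-(τ * D))) := by ring
      _ ≤ B₃ * (m * Real.exp (-(τ * D))) := mul_le_mul_of_nonneg_right hB₃ hmE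
      _ = B₃ * m * Real.exp (-(τ * D)) := by ring
      _ ≤ B₃ * (K * (B₅ * M ^ 5 * εk)) * Real.exp (-(τ * D)) :=
          mul_le_mul_of_nonneg_right (mul_le_mul_of_nonneg_left hmK hB₃0) hE0
      _ = K * (B₃ * B₅ * M ^ 5 * Real.exp (-τ * D) * εk) := by rw [neg_mul]; ring
  have hP' : 0 ≤ B₃ * B₅ * M ^ 5 * εk := by
    have h := mul_nonneg hB₃0 hP
    have e : B₃ * (B₅ * M ^ 5 * εk) = B₃ * B₅ * M ^ 5 * εk := by ring
    rw [e] at h; exact h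
  exact ineq180_lattice hη h₁ hH hg μ ν x hH₁ hH₂ hH₃ hH₄ hDH hX' hK hP' (mul_nonneg hτ hD0) hsmall h175

end Literature.MathematicalPhysics.QuantumFieldTheory.Balaban1983to89.B15Ineq180Lattice
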